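import Mathlib
import Literature.Computability.AlgebraicComplexity.NewtonPolygonTauProductBounds
import Summits.ValiantsHypothesis.ValiantsHypothesis.Theorems.NewtonUnitEquationsDissociatedUniformTotalsLawStaircase
import Summits.ValiantsHypothesis.ValiantsHypothesis.Theorems.NewtonUnitEquationsDissociatedUniformTotalsLawIntervalUnionLinear
import Summits.ValiantsHypothesis.ValiantsHypothesis.Theorems.NewtonUnitEquationsDissociatedUniformTotalsLawDominance
import HarnessLib

/-!
# Crux `NewtonUnitEquations.DissociatedUniform` (stmt-ValiantsHypothesis-5905), `n = 3` totals law of model (Q**):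
# INTERVAL SYSTEMS — stabbed families are LINEAR, and rows never pay the logarithm

Memo `Cruxes/DissociatedUniform/NOTES-t1g18.md`.  An INTERVAL SYSTEM is the restricted sum
`W = {v i + b y : i ∈ R, l i ≤ y < u i}` of finitely many translates `v i` ("rows", each carrying an integer interval
`[l i, u i)`) of a point sequence `b : ℕ → ℝ²` ("columns").  Interval systems are dominance sums (`…TotalsLawDominance`), so
`#vert conv W = O((#rows + #columns)·log)` is known (`Stair.ncard_extremePoints_domPts_le`); memo `NOTES-t1g17.md` §6(ii) located
the conjecture that the logarithm can be removed ("interval-bigraph hull bound", "DominanceLinear").  This file proves the two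
log-free statements that ARE true:
* `Stair.ncard_extremePoints_ivlPts_le_of_stabbed` — **STABBED interval systems are linear**: if one column index `p` lies in every
  `[l i, u i]` and the intervals live in a window of `N` columns, then `#vert conv W ≤ 8·#R + 4·N`.  Proof: cut every interval at
  `p`; the left parts `{l i ≤ y < p}` form a STAIRCASE (half-graph) restricted sum and so do the right parts `{p ≤ y < u i}`
  (`ivlPts_eq_union_of_stabbed`), and `…TotalsLawStaircase.Stair.ncard_extremePoints_stairPts_le` bounds each by
  `4·(#rows + #columns)`.  (In the language of lower envelopes this is the classical fact that segments crossing a common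
  vertical line have envelopes of linear complexity.)
* `Stair.ncard_extremePoints_ivlPts_le_pow` — **the interval-tree bound** `#vert conv W ≤ 8·#R + 4·K·2^K` for intervals inside
  `[0, 2^K)`: every interval of length `≥ 2` is stabbed by the centre of its lowest common dyadic ancestor
  (`…TotalsLawDominance.Stair.exists_dyadic_split`), the rows of one dyadic node form a stabbed family in a window of `2^ℓ`
  columns, and the `2^{K-ℓ}` nodes of level `ℓ` cost `4·2^K` columns in total; rows are paid ONCE (no logarithm on `#R`),
  columns once per level.  `Stair.ncard_extremePoints_ivlPts_le_size` is the form with `u i ≤ M` (`K = Nat.size M`).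
What is NOT here (memo §2): the conjectured fully linear bound is FALSE asymptotically — in the stiff regime interval systems
are exactly lower envelopes of line segments, which reach `Ω(n·α(n))` pieces (Wiernik–Sharir 1988); no finite certificate is
feasible and all finite ratios `#vert/(#R + #C)` observed stay below `2`.  Honest label: a planar incidence tool;
`UnionTotalsLaw C`, `TriWordsBound C`, `TotalsLawThree C` remain OPEN and are asserted nowhere; nothing here bears on VP ≠ VNP.
[folklore: interval trees; envelopes of segments with a common stabbing line]
-/

set_option linter.dupNamespace false -- `ValiantsHypothesis.ValiantsHypothesis` (summit = problem) in every name

open Finset Matrix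
open scoped Pointwise

namespace Summit.ValiantsHypothesis.ValiantsHypothesis.Theorems.NewtonUnitEquationsDissociatedUniform

namespace TotalsLaw

namespace Stair

open Literature.Computability.AlgebraicComplexity.KPTT.PlanarMinkowski

variable {ι : Type*} [Fintype ι]

/-! ### Interval systems -/

/-- The INTERVAL SYSTEM `{v i + b y : i ∈ R, l i ≤ y < u i}`: translates `v i` of the column windows `b[l i, u i)`. -/
noncomputable def ivlPts (R : Finset ι) (v : ι → (Fin 2 → ℝ)) (b : ℕ → (Fin 2 → ℝ)) (l u : ι → ℕ) :
    Finset (Fin 2 → ℝ) :=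
  R.biUnion fun i => (Finset.Ico (l i) (u i)).image fun y => v i + b y

omit [Fintype ι] in
/-- Membership in `ivlPts`. [folklore] -/
theorem mem_ivlPts {R : Finset ι} {v : ι → (Fin 2 → ℝ)} {b : ℕ → (Fin 2 → ℝ)} {l u : ι → ℕ} {x : Fin 2 → ℝ} :
    x ∈ ivlPts R v b l u ↔ ∃ i ∈ R, ∃ y, l i ≤ y ∧ y < u i ∧ v i + b y = x := by
  simp only [ivlPts, Finset.mem_biUnion, Finset.mem_image, Finset.mem_Ico]
  constructor
  · rintro ⟨i, hi, y, ⟨h1, h2⟩, h⟩; exact ⟨i, hi, y, h1, h2, h⟩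
  · rintro ⟨i, hi, y, h1, h2, h⟩; exact ⟨i, hi, y, ⟨h1, h2⟩, h⟩

omit [Fintype ι] in
/-- `ivlPts` is monotone in the row set. [folklore] -/
theorem ivlPts_mono {R R' : Finset ι} (h : R ⊆ R') (v : ι → (Fin 2 → ℝ)) (b : ℕ → (Fin 2 → ℝ)) (l u : ι → ℕ) :
    ivlPts R v b l u ⊆ ivlPts R' v b l u := by
  intro x hx
  obtain ⟨i, hi, y, h1, h2, h3⟩ := mem_ivlPts.1 hx
  exact mem_ivlPts.2 ⟨i, h hi, y, h1, h2, h3⟩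

omit [Fintype ι] in
/-- `ivlPts` over a `biUnion` of row sets is the `biUnion` of the `ivlPts`. [folklore] -/
theorem ivlPts_biUnion {α : Type*} [DecidableEq ι] (S : Finset α) (f : α → Finset ι) (v : ι → (Fin 2 → ℝ))
    (b : ℕ → (Fin 2 → ℝ)) (l u : ι → ℕ) :
    ivlPts (S.biUnion f) v b l u = S.biUnion fun a => ivlPts (f a) v b l u := by
  ext x
  simp only [mem_ivlPts, Finset.mem_biUnion]
  constructor
  · rintro ⟨i, ⟨a, ha, hi⟩, y, h1, h2, h3⟩; exact ⟨a, ha, i, hi, y, h1, h2, h3⟩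
  · rintro ⟨a, ha, i, hi, y, h1, h2, h3⟩; exact ⟨i, ⟨a, ha, hi⟩, y, h1, h2, h3⟩

/-- The set form: `⋃ i, (v i +ᵥ b '' [l i, u i))` is the interval system over all rows. [folklore] -/
theorem iUnion_vadd_image_Ico_eq (v : ι → (Fin 2 → ℝ)) (b : ℕ → (Fin 2 → ℝ)) (l u : ι → ℕ) :
    (⋃ i, (v i +ᵥ (b '' Set.Ico (l i) (u i)))) = (ivlPts Finset.univ v b l u : Set (Fin 2 → ℝ)) := by
  ext x
  simp only [Set.mem_iUnion, Finset.mem_coe, mem_ivlPts, Finset.mem_univ, true_and]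
  constructor
  · rintro ⟨i, hx⟩
    rw [Set.mem_vadd_set] at hx
    obtain ⟨z, ⟨y, ⟨h1, h2⟩, rfl⟩, rfl⟩ := hx
    exact ⟨i, y, h1, h2, (vadd_eq_add _ _).symm⟩
  · rintro ⟨i, y, h1, h2, h⟩
    refine ⟨i, ?_⟩
    rw [Set.mem_vadd_set]
    exact ⟨b y, ⟨y, ⟨h1, h2⟩, rfl⟩, by rw [vadd_eq_add, h]⟩

/-! ### Stabbed families: two staircases -/

/-- The LEFT staircase of a family stabbed at `p` (columns `A ≤ y < p`, relation `l i ≤ y`). -/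
noncomputable def ivlLeft (R : Finset ι) (v : ι → (Fin 2 → ℝ)) (b : ℕ → (Fin 2 → ℝ)) (l : ι → ℕ) (A p : ℕ) :
    Finset (Fin 2 → ℝ) :=
  stairPts R (Finset.Ico A p) (winRowPos l 0) (winColPos ι) v b

/-- The RIGHT staircase of a family stabbed at `p` (columns `p ≤ y < B`, relation `y < u i`; the columns are the "rows" of
the staircase). -/
noncomputable def ivlRight (R : Finset ι) (v : ι → (Fin 2 → ℝ)) (b : ℕ → (Fin 2 → ℝ)) (u : ι → ℕ) (p B : ℕ) :
    Finset (Fin 2 → ℝ) :=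
  stairPts (Finset.Ico p B) R (winColPos ι) (winRowPos u 0) b v

/-- **Splitting a stabbed family at the stab.**  If `A ≤ l i ≤ p ≤ u i ≤ B` for every row, the interval system is the union
of its left staircase and its right staircase. [folklore] -/
theorem ivlPts_eq_union_of_stabbed [DecidableEq (Fin 2 → ℝ)] {R : Finset ι} {v : ι → (Fin 2 → ℝ)} {b : ℕ → (Fin 2 → ℝ)}
    {l u : ι → ℕ} {A p B : ℕ} (hA : ∀ i ∈ R, A ≤ l i) (hst : ∀ i ∈ R, l i ≤ p ∧ p ≤ u i) (hB : ∀ i ∈ R, u i ≤ B) :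
    ivlPts R v b l u = ivlLeft R v b l A p ∪ ivlRight R v b u p B := by
  ext x
  rw [mem_ivlPts, Finset.mem_union, ivlLeft, ivlRight, mem_stairPts, mem_stairPts]
  constructor
  · rintro ⟨i, hi, y, h1, h2, h3⟩
    by_cases hy : y < p
    · left
      refine ⟨i, hi, y, Finset.mem_Ico.2 ⟨(hA i hi).trans h1, hy⟩, ?_, h3⟩
      rw [winRowPos_lt_winColPos_iff, Nat.mod_zero]; exact h1
    · right
      push Not at hy
      refine ⟨y, Finset.mem_Ico.2 ⟨hy, h2.trans_le (hB i hi)⟩, i, hi, ?_, by rw [add_comm, h3]⟩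
      rw [winColPos_lt_winRowPos_iff, Nat.mod_zero]; exact h2
  · rintro (⟨i, hi, y, hy, hlt, h⟩ | ⟨y, hy, i, hi, hlt, h⟩)
    · rw [winRowPos_lt_winColPos_iff, Nat.mod_zero] at hlt
      exact ⟨i, hi, y, hlt, (Finset.mem_Ico.1 hy).2.trans_le (hst i hi).2, h⟩
    · rw [winColPos_lt_winRowPos_iff, Nat.mod_zero] at hlt
      exact ⟨i, hi, y, (hst i hi).1.trans (Finset.mem_Ico.1 hy).1, hlt, by rw [add_comm, h]⟩

/-- `#vert conv (S ∪ P) ≤ #vert conv S + #vert conv P` for finite planar sets. [folklore] -/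
private theorem ncard_extremePoints_union_le' (S P : Finset (Fin 2 → ℝ)) :
    ((convexHull ℝ ((S ∪ P : Finset (Fin 2 → ℝ)) : Set (Fin 2 → ℝ))).extremePoints ℝ).ncard ≤
      ((convexHull ℝ (S : Set (Fin 2 → ℝ))).extremePoints ℝ).ncard +
        ((convexHull ℝ (P : Set (Fin 2 → ℝ))).extremePoints ℝ).ncard := by
  classical
  have h := ncard_extremePoints_biUnion_le ({0, 1} : Finset ℕ) (fun k => if k = 0 then S else P)
  have h1 : (({0, 1} : Finset ℕ).biUnion fun k => if k = 0 then S else P) = S ∪ P := by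
    rw [Finset.biUnion_insert, Finset.singleton_biUnion, if_pos rfl, if_neg Nat.one_ne_zero]
  rw [h1, Finset.sum_insert (by simp), Finset.sum_singleton, if_pos rfl, if_neg Nat.one_ne_zero] at h
  exact h

/-- **STABBED INTERVAL SYSTEMS ARE LINEAR.**  If every interval `[l i, u i]` (`i ∈ R`) contains the column index `p` and lies in
the window `[A, A + N]`, then `#vert conv {v i + b y : i ∈ R, l i ≤ y < u i} ≤ 8·#R + 4·N`. [folklore] -/
theorem ncard_extremePoints_ivlPts_le_of_stabbed {R : Finset ι} {v : ι → (Fin 2 → ℝ)} {b : ℕ → (Fin 2 → ℝ)} {l u : ι → ℕ}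
    {A p N : ℕ} (hA : ∀ i ∈ R, A ≤ l i) (hst : ∀ i ∈ R, l i ≤ p ∧ p ≤ u i) (hB : ∀ i ∈ R, u i ≤ A + N) (hpA : A ≤ p)
    (hpN : p ≤ A + N) :
    ((convexHull ℝ (ivlPts R v b l u : Set (Fin 2 → ℝ))).extremePoints ℝ).ncard ≤ 8 * R.card + 4 * N := by
  classical
  rw [ivlPts_eq_union_of_stabbed hA hst hB]
  have hL : ((convexHull ℝ (ivlLeft R v b l A p : Set (Fin 2 → ℝ))).extremePoints ℝ).ncard ≤
      4 * (R.card + (p - A)) := by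
    have h := ncard_extremePoints_stairPts_le (R := R) (C := Finset.Ico A p) (v := v) (b := b)
      (winRowPos_injective l 0) (winColPos_injective ι)
    rw [Nat.card_Ico] at h
    exact h
  have hRt : ((convexHull ℝ (ivlRight R v b u p (A + N) : Set (Fin 2 → ℝ))).extremePoints ℝ).ncard ≤
      4 * ((A + N - p) + R.card) := by
    have h := ncard_extremePoints_stairPts_le (R := Finset.Ico p (A + N)) (C := R) (v := b) (b := v)
      (winColPos_injective ι) (winRowPos_injective u 0)
    rw [Nat.card_Ico] at h
    exact h
  have hU := ncard_extremePoints_union_le' (ivlLeft R v b l A p) (ivlRight R v b u p (A + N))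
  omega

/-- **Stabbed interval systems, set form:** for rows indexed by a finite type, if every `[l i, u i]` contains `p` and `u i ≤ N`,
then `#vert conv ⋃ i (v i + b[l i, u i)) ≤ 8·|ι| + 4·N`. [folklore] -/
theorem ncard_extremePoints_iUnion_le_of_stabbed (v : ι → (Fin 2 → ℝ)) (b : ℕ → (Fin 2 → ℝ)) (l u : ι → ℕ) (p N : ℕ)
    (hst : ∀ i, l i ≤ p ∧ p ≤ u i) (hN : ∀ i, u i ≤ N) (hpN : p ≤ N) :
    (Set.extremePoints ℝ (convexHull ℝ (⋃ i, (v i +ᵥ (b '' Set.Ico (l i) (u i)))))).ncard ≤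
      8 * Fintype.card ι + 4 * N := by
  rw [iUnion_vadd_image_Ico_eq, ← Finset.card_univ]
  exact ncard_extremePoints_ivlPts_le_of_stabbed (A := 0) (p := p) (fun i _ => Nat.zero_le _) (fun i _ => hst i)
    (fun i _ => by rw [Nat.zero_add]; exact hN i) (Nat.zero_le _) (by rw [Nat.zero_add]; exact hpN)

/-! ### The interval tree: rows never pay the logarithm -/

section Tree

variable {R : Finset ι} {v : ι → (Fin 2 → ℝ)} {b : ℕ → (Fin 2 → ℝ)} {l u : ι → ℕ}

/-- The dyadic NODE `(ℓ, t)` of a row: the lowest common dyadic ancestor of `l i` and `u i - 1` below `2^K`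
(`…TotalsLawDominance.Stair.exists_dyadic_split`); junk `(0, 0)` unless `l i + 1 < u i ≤ 2^K`. -/
noncomputable def node (K : ℕ) (l u : ι → ℕ) (i : ι) : ℕ × ℕ :=
  if h : l i < u i - 1 ∧ u i - 1 < 2 ^ K then
    ((exists_dyadic_split K (l i) (u i - 1) h.1 h.2).choose,
      (exists_dyadic_split K (l i) (u i - 1) h.1 h.2).choose_spec.choose)
  else (0, 0)

omit [Fintype ι] in
/-- The defining property of the node of a row of length `≥ 2` inside `[0, 2^K)`. [folklore] -/
theorem node_spec (K : ℕ) {i : ι} (h1 : l i < u i - 1) (h2 : u i - 1 < 2 ^ K) :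
    1 ≤ (node K l u i).1 ∧ (node K l u i).1 ≤ K ∧ l i / 2 ^ ((node K l u i).1 - 1) = 2 * (node K l u i).2 ∧
      (u i - 1) / 2 ^ ((node K l u i).1 - 1) = 2 * (node K l u i).2 + 1 := by
  unfold node
  rw [dif_pos ⟨h1, h2⟩]
  exact (exists_dyadic_split K (l i) (u i - 1) h1 h2).choose_spec.choose_spec

/-- The rows of length `≥ 2` whose node is `n`. -/
noncomputable def treeRows (R : Finset ι) (K : ℕ) (l u : ι → ℕ) (n : ℕ × ℕ) : Finset ι :=
  R.filter fun i => l i + 1 < u i ∧ node K l u i = n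

/-- The rows with a one-point interval. -/
noncomputable def unitRows (R : Finset ι) (l u : ι → ℕ) : Finset ι :=
  R.filter fun i => u i = l i + 1

/-- The dyadic nodes `(ℓ, t)`, `1 ≤ ℓ ≤ K`, `t < 2^{K-ℓ}`, as a sigma-type index set. -/
def nodes (K : ℕ) : Finset (Σ _ : ℕ, ℕ) :=
  (Finset.Icc 1 K).sigma fun ℓ => Finset.range (2 ^ (K - ℓ))

omit [Fintype ι] in
/-- **The window of a node.**  A row of node `(ℓ, t)` (with `u i ≤ 2^K`) satisfies
`2t·2^{ℓ-1} ≤ l i ≤ (2t+1)·2^{ℓ-1} ≤ u i ≤ 2t·2^{ℓ-1} + 2^ℓ`, and `1 ≤ ℓ ≤ K`, `t < 2^{K-ℓ}`. [folklore] -/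
theorem treeRows_window {K : ℕ} (hK : ∀ i ∈ R, u i ≤ 2 ^ K) {n : ℕ × ℕ} {i : ι} (hi : i ∈ treeRows R K l u n) :
    (1 ≤ n.1 ∧ n.1 ≤ K ∧ n.2 < 2 ^ (K - n.1)) ∧ 2 * n.2 * 2 ^ (n.1 - 1) ≤ l i ∧
      (l i ≤ (2 * n.2 + 1) * 2 ^ (n.1 - 1) ∧ (2 * n.2 + 1) * 2 ^ (n.1 - 1) ≤ u i) ∧
        u i ≤ 2 * n.2 * 2 ^ (n.1 - 1) + 2 ^ n.1 := by
  obtain ⟨hiR, hlu, hn⟩ := Finset.mem_filter.1 hi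
  have huK : u i - 1 < 2 ^ K := by have := hK i hiR; omega
  obtain ⟨hℓ1, hℓK, hl, hu⟩ := node_spec K (show l i < u i - 1 by omega) huK
  rw [hn] at hℓ1 hℓK hl hu
  have hpos : 0 < 2 ^ (n.1 - 1) := Nat.pos_of_ne_zero (by positivity)
  have e2 : (2 : ℕ) ^ n.1 = 2 * 2 ^ (n.1 - 1) := by rw [← pow_succ']; congr 1; omega
  have eK : (2 : ℕ) ^ K = 2 ^ (n.1 - 1) * (2 * 2 ^ (K - n.1)) := by
    rw [← pow_succ', ← pow_add]; congr 1; omega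
  have h1 := Nat.div_mul_le_self (l i) (2 ^ (n.1 - 1))
  have h2 := Nat.lt_div_mul_add hpos (a := l i)
  have h3 := Nat.div_mul_le_self (u i - 1) (2 ^ (n.1 - 1))
  have h4 := Nat.lt_div_mul_add hpos (a := u i - 1)
  rw [hl] at h1 h2
  rw [hu] at h3 h4
  have h5 : (2 * n.2 + 1) * 2 ^ (n.1 - 1) = 2 * n.2 * 2 ^ (n.1 - 1) + 2 ^ (n.1 - 1) := by ring
  refine ⟨⟨hℓ1, hℓK, ?_⟩, h1, ⟨?_, ?_⟩, ?_⟩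
  · -- `(2t+1)·2^{ℓ-1} ≤ u i - 1 < 2^K = 2^{ℓ-1}·(2·2^{K-ℓ})`
    have h6 : (2 * n.2 + 1) * 2 ^ (n.1 - 1) < 2 ^ (n.1 - 1) * (2 * 2 ^ (K - n.1)) := by
      rw [← eK]; omega
    rw [Nat.mul_comm] at h6
    have h7 := Nat.lt_of_mul_lt_mul_left h6
    omega
  · rw [h5]; exact h2.le
  · omega
  · rw [e2]; omega

omit [Fintype ι] in
/-- **Interval-tree decomposition.**  With `u i ≤ 2^K` on `R`, the interval system is covered by the one-point rows' points
and by the interval systems of the node row-sets over the dyadic nodes. [folklore] -/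
theorem ivlPts_subset_tree [DecidableEq (Fin 2 → ℝ)] [DecidableEq ι] (K : ℕ) (hK : ∀ i ∈ R, u i ≤ 2 ^ K) :
    ivlPts R v b l u ⊆ ivlPts (unitRows R l u) v b l u ∪
      (nodes K).biUnion fun n => ivlPts (treeRows R K l u (n.1, n.2)) v b l u := by
  intro x hx
  obtain ⟨i, hi, y, h1, h2, h3⟩ := mem_ivlPts.1 hx
  rw [Finset.mem_union, Finset.mem_biUnion]
  by_cases hunit : u i = l i + 1
  · exact Or.inl (mem_ivlPts.2 ⟨i, Finset.mem_filter.2 ⟨hi, hunit⟩, y, h1, h2, h3⟩)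
  · right
    have hlu : l i + 1 < u i := by omega
    have hmem : i ∈ treeRows R K l u (node K l u i) := Finset.mem_filter.2 ⟨hi, hlu, rfl⟩
    obtain ⟨⟨hℓ1, hℓK, ht⟩, -⟩ := treeRows_window hK hmem
    refine ⟨⟨(node K l u i).1, (node K l u i).2⟩, ?_, mem_ivlPts.2 ⟨i, hmem, y, h1, h2, h3⟩⟩
    exact Finset.mem_sigma.2 ⟨Finset.mem_Icc.2 ⟨hℓ1, hℓK⟩, Finset.mem_range.2 ht⟩

omit [Fintype ι] in
/-- The one-point rows contribute at most `#unitRows` points. [folklore] -/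
theorem card_ivlPts_unitRows_le [DecidableEq ι] : (ivlPts (unitRows R l u) v b l u).card ≤ (unitRows R l u).card := by
  classical
  unfold ivlPts
  refine Finset.card_biUnion_le.trans ?_
  refine (Finset.sum_le_sum (g := fun _ => 1) fun i hi => ?_).trans (by simp)
  obtain ⟨-, hu⟩ := Finset.mem_filter.1 hi
  refine Finset.card_image_le.trans ?_
  rw [Nat.card_Ico]; omega

omit [Fintype ι] in
/-- Rows are paid ONCE: the node row-sets are pairwise disjoint, so `Σ_nodes #treeRows ≤ #(rows of length ≥ 2)`. [folklore] -/
theorem sum_card_treeRows_le [DecidableEq ι] (K : ℕ) :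
    ∑ n ∈ nodes K, (treeRows R K l u (n.1, n.2)).card ≤ (R.filter fun i => l i + 1 < u i).card := by
  classical
  have hdisj : ((nodes K : Finset (Σ _ : ℕ, ℕ)) : Set (Σ _ : ℕ, ℕ)).PairwiseDisjoint
      fun n => treeRows R K l u (n.1, n.2) := by
    intro n _ n' _ hne
    rw [Function.onFun, Finset.disjoint_left]
    intro i hi hi'
    have e1 := (Finset.mem_filter.1 hi).2.2
    have e2 := (Finset.mem_filter.1 hi').2.2
    have e3 : (n.1, n.2) = (n'.1, n'.2) := e1.symm.trans e2
    apply hne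
    obtain ⟨a, c⟩ := n
    obtain ⟨a', c'⟩ := n'
    simp only [Prod.mk.injEq] at e3
    obtain ⟨rfl, rfl⟩ := e3
    rfl
  rw [← Finset.card_biUnion hdisj]
  refine Finset.card_le_card (Finset.biUnion_subset.2 fun n _ => ?_)
  intro i hi
  obtain ⟨hiR, hlu, -⟩ := Finset.mem_filter.1 hi
  exact Finset.mem_filter.2 ⟨hiR, hlu⟩

/-- Columns are paid once per level: `Σ_nodes 2^ℓ = K·2^K`. [folklore] -/
theorem sum_pow_nodes (K : ℕ) : ∑ n ∈ nodes K, 2 ^ n.1 = K * 2 ^ K := by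
  unfold nodes
  rw [Finset.sum_sigma]
  calc ∑ ℓ ∈ Finset.Icc 1 K, ∑ _t ∈ Finset.range (2 ^ (K - ℓ)), 2 ^ ℓ
      = ∑ ℓ ∈ Finset.Icc 1 K, 2 ^ K := by
        refine Finset.sum_congr rfl fun ℓ hℓ => ?_
        rw [Finset.sum_const, Finset.card_range, smul_eq_mul, ← pow_add]
        congr 1
        have := (Finset.mem_Icc.1 hℓ).2
        omega
    _ = K * 2 ^ K := by rw [Finset.sum_const, Nat.card_Icc, smul_eq_mul, Nat.add_sub_cancel]

/-- **THE INTERVAL-TREE HULL BOUND.**  For rows `i ∈ R` with intervals `[l i, u i) ⊆ [0, 2^K)`: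
`#vert conv {v i + b y : l i ≤ y < u i} ≤ 8·#R + 4·K·2^K` — rows are paid once, columns once per level. [folklore] -/
theorem ncard_extremePoints_ivlPts_le_pow (K : ℕ) (hK : ∀ i ∈ R, u i ≤ 2 ^ K) :
    ((convexHull ℝ (ivlPts R v b l u : Set (Fin 2 → ℝ))).extremePoints ℝ).ncard ≤ 8 * R.card + 4 * K * 2 ^ K := by
  classical
  -- the tree cover is an equality
  set U := ivlPts (unitRows R l u) v b l u ∪
    (nodes K).biUnion fun n => ivlPts (treeRows R K l u (n.1, n.2)) v b l u with hU
  have hEq : ivlPts R v b l u = U := by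
    refine Finset.Subset.antisymm (ivlPts_subset_tree K hK) (Finset.union_subset ?_ ?_)
    · exact ivlPts_mono (Finset.filter_subset _ _) v b l u
    · exact Finset.biUnion_subset.2 fun n _ => ivlPts_mono (Finset.filter_subset _ _) v b l u
  rw [hEq, hU]
  refine (ncard_extremePoints_union_le' _ _).trans ?_
  -- one-point rows
  have h1 : ((convexHull ℝ (ivlPts (unitRows R l u) v b l u : Set (Fin 2 → ℝ))).extremePoints ℝ).ncard ≤
      (unitRows R l u).card := (ncard_extremePoints_le_card _).trans card_ivlPts_unitRows_le
  -- each node is a stabbed family in a window of `2^ℓ` columns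
  have hnode : ∀ n ∈ nodes K,
      ((convexHull ℝ (ivlPts (treeRows R K l u (n.1, n.2)) v b l u : Set (Fin 2 → ℝ))).extremePoints ℝ).ncard ≤
        8 * (treeRows R K l u (n.1, n.2)).card + 4 * 2 ^ n.1 := by
    intro n hn
    have hn1 : 1 ≤ n.1 := (Finset.mem_Icc.1 (Finset.mem_sigma.1 hn).1).1
    have e2 : (2 : ℕ) ^ n.1 = 2 * 2 ^ (n.1 - 1) := by rw [← pow_succ']; congr 1; omega
    have h5 : (2 * n.2 + 1) * 2 ^ (n.1 - 1) = 2 * n.2 * 2 ^ (n.1 - 1) + 2 ^ (n.1 - 1) := by ring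
    refine ncard_extremePoints_ivlPts_le_of_stabbed (A := 2 * n.2 * 2 ^ (n.1 - 1))
      (p := (2 * n.2 + 1) * 2 ^ (n.1 - 1)) (N := 2 ^ n.1) (fun i hi => (treeRows_window hK hi).2.1)
      (fun i hi => (treeRows_window hK hi).2.2.1) (fun i hi => (treeRows_window hK hi).2.2.2) ?_ ?_
    · rw [h5]; omega
    · rw [h5, e2]; omega
  have h2 := (ncard_extremePoints_biUnion_le (nodes K) fun n => ivlPts (treeRows R K l u (n.1, n.2)) v b l u).trans
    (Finset.sum_le_sum hnode)
  rw [Finset.sum_add_distrib, ← Finset.mul_sum, ← Finset.mul_sum, sum_pow_nodes] at h2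
  have h3 := sum_card_treeRows_le (R := R) (l := l) (u := u) K
  -- unit rows and long rows are disjoint parts of `R`
  have h4 : (unitRows R l u).card + (R.filter fun i => l i + 1 < u i).card ≤ R.card := by
    rw [unitRows, ← Finset.card_union_of_disjoint]
    · exact Finset.card_le_card (Finset.union_subset (Finset.filter_subset _ _) (Finset.filter_subset _ _))
    · rw [Finset.disjoint_left]
      intro i hi hi'
      have e1 := (Finset.mem_filter.1 hi).2
      have e2 := (Finset.mem_filter.1 hi').2
      omega
  have h5 : 4 * (K * 2 ^ K) = 4 * K * 2 ^ K := by ring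
  omega

/-- **Interval systems with `u i ≤ M` have `≤ 8·#R + 4·size(M)·2^{size M} ≤ 8·#R + 8·size(M)·M` hull vertices** (for `M ≥ 1`;
`size M = ⌊log₂ M⌋ + 1`). [folklore] -/
theorem ncard_extremePoints_ivlPts_le_size (M : ℕ) (hM : ∀ i ∈ R, u i ≤ M) :
    ((convexHull ℝ (ivlPts R v b l u : Set (Fin 2 → ℝ))).extremePoints ℝ).ncard ≤
      8 * R.card + 4 * Nat.size M * 2 ^ Nat.size M :=
  ncard_extremePoints_ivlPts_le_pow (Nat.size M) fun i hi => (hM i hi).trans (Nat.lt_size_self M).le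

/-- **Set form over a finite row type:** `#vert conv ⋃ i (v i + b[l i, u i)) ≤ 8·|ι| + 4·K·2^K` when `u i ≤ 2^K`. [folklore] -/
theorem ncard_extremePoints_iUnion_le_pow (v : ι → (Fin 2 → ℝ)) (b : ℕ → (Fin 2 → ℝ)) (l u : ι → ℕ) (K : ℕ)
    (hK : ∀ i, u i ≤ 2 ^ K) :
    (Set.extremePoints ℝ (convexHull ℝ (⋃ i, (v i +ᵥ (b '' Set.Ico (l i) (u i)))))).ncard ≤
      8 * Fintype.card ι + 4 * K * 2 ^ K := by
  rw [iUnion_vadd_image_Ico_eq, ← Finset.card_univ]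
  exact ncard_extremePoints_ivlPts_le_pow K fun i _ => hK i

end Tree

end Stair

end TotalsLaw

end Summit.ValiantsHypothesis.ValiantsHypothesis.Theorems.NewtonUnitEquationsDissociatedUniform
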